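import Mathlib
import HarnessLib
import Summits.ValiantsHypothesis.ValiantsHypothesis.Theses.MonotoneRestoration
import Literature.Computability.AlgebraicComplexity.ArithCircuit
import Literature.Computability.AlgebraicComplexity.ArithCircuitProofs
import Literature.Computability.AlgebraicComplexity.MonotoneStructure
import Literature.Computability.AlgebraicComplexity.PermanentIrreducible
import Literature.ModelTheory.FiniteModelTheory.CkEquiv
import Summits.ValiantsHypothesis.ValiantsHypothesis.Theorems.MonotoneRestorationMonotoneRestorationQPCosetCount
import Summits.ValiantsHypothesis.ValiantsHypothesis.Theorems.MonotoneRestorationMonotoneRestorationQPSymmetricLB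
import Summits.ValiantsHypothesis.ValiantsHypothesis.Theorems.MonotoneRestorationMonotoneRestorationQPSupportSymmetrisation
import Summits.ValiantsHypothesis.ValiantsHypothesis.Theorems.MonotoneRestorationMonotoneRestorationQPSparseRegime
import Summits.ValiantsHypothesis.ValiantsHypothesis.Theorems.MonotoneRestorationMonotoneRestorationQPBeta
import Literature.Computability.AlgebraicComplexity.SymmetricArithCircuit
import Literature.Computability.AlgebraicComplexity.DawarWilsenach2025Proofs
import Literature.GroupTheory.PermutationGroups.SmallIndexSubgroups
import Summits.ValiantsHypothesis.ValiantsHypothesis.Theorems.MonotoneRestorationQP.Negative.LoadBearing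
import Summits.ValiantsHypothesis.ValiantsHypothesis.Theorems.MonotoneRestorationMonotoneRestorationQPPermSupportCount

/-! TTRL-lite variant V19203 of stmt-ValiantsHypothesis-15886

Target `stub_esymmRowSums_structure` (slug `valian15886-stub-esymmrowsums-stru`), move `drop_hyp`
(BOUNDARY PROBE, FALSE): dropping the coupling `k = n / 2` and asking that
`e_k(R_1, …, R_n) ≠ 0` for *all* `n k` (`R_i = Σ_j x_{i,j}` over `ℝ≥0`) fails as soon as `n < k`,
where `e_k` of `n` things is the empty sum. Minimal witness `(n, k) = (0, 1)`.
-/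

-- `Summit.ValiantsHypothesis.ValiantsHypothesis.…` is the tree's mandated single-conjunct layout
-- (Sub = Summit), so the duplicated namespace component is intended.
set_option linter.dupNamespace false

namespace Summit.ValiantsHypothesis.ValiantsHypothesis.Theorems

open Summit.ValiantsHypothesis.ValiantsHypothesis.Theses.MonotoneRestoration
open Literature.Computability.AlgebraicComplexity

/-- **TTRL-lite variant V19203 (boundary probe, FALSE)** of `stub_esymmRowSums_structure`
(`stmt-ValiantsHypothesis-15886`): it is *not* the case that for all `n k : ℕ` the row-sum
substitution of the elementary symmetric polynomial, `e_k(R_1, …, R_n)` with `R_i = Σ_j x_{i,j}`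
over `ℝ≥0`, is nonzero. Witness `(n, k) = (0, 1)`: `e_1` over the empty index type `Fin 0` is a
sum over `powersetCard 1 univ = ∅`, hence `0`, and `bind₁ _ 0 = 0`. (More generally the claim
fails exactly when `n < k`; the parent stub only uses `k = n / 2 ≤ n`.) -/
theorem stub_esymmRowSums_structure_var19203_false :
    ¬ (∀ (n k : ℕ), MvPolynomial.bind₁ (fun i : Fin n => ∑ j : Fin n, MvPolynomial.X (i, j))
      (MvPolynomial.esymm (Fin n) NNReal k) ≠ 0) := by
  intro h
  apply h 0 1
  have h0 : MvPolynomial.esymm (Fin 0) NNReal 1 = 0 := by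
    rw [MvPolynomial.esymm, Finset.powersetCard_eq_empty.2 (by simp), Finset.sum_empty]
  rw [h0, map_zero]

end Summit.ValiantsHypothesis.ValiantsHypothesis.Theorems
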